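import Literature.NumberTheory.PAdicHodge.LabelledWeightsInduceSchemaProofs
import HarnessLib

/-!
# The induction formula for labelled Hodge–Tate weights holds for EVERY family of labels above `(v, τ)`
# (Patrikis 2019, Lemma 7.2.1; Neukirch II (8.1)–(8.3): the labels above are the extensions of `τ`)

Topic `NumberTheory/PAdicHodge`.  PROOF FILE (theorems only: no definition, no named fact, no
instance; D-0026).  The discharged schema `labelledHodgeTateWeightsAtLabel_induce`
(`LabelledWeightsInduceSchemaProofs`) produces SOME family of `d = [E : K]` labels `(w_i, σ_i)` of `E`
above a label `(v, τ)` of `K` with `HT_{(v,τ)}(Ind_{Γ_E}^{Γ_K} W) = Σ_i HT_{(w_i,σ_i)}(W)`.  Here: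

* `labelledHodgeTateWeightsAtLabel_induce_eq_sum` — the formula holds for EVERY family of `d` labels
  of `E` above `(v, τ)` with pairwise distinct global embeddings (two such families differ by a
  permutation matching global embeddings, `PinnedLabel.range_emb_eq_of_labels_above`, and the
  labelled weights at a label depend only on its global embedding,
  `labelledHodgeTateWeightsAtLabel_eq_of_emb_eq`), so consumers may plug in their own enumeration of
  the embeddings `E → ℚ̄_ℓ` extending `τ.emb`;
* `labelledHodgeTateWeightsAtLabel_induce_of_forall_eq` — if all labelled weights of `W` above `ℓ`
  are one multiset `S`, then `HT_{(v,τ)}(Ind W) = d • S` (the shape of the tree's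
  `labelledHodgeTateWeightsAt_induce_of_parallel`, for arbitrary rank and weights);
* `card_labelledHodgeTateWeightsAtLabel_induce` — `#HT_{(v,τ)}(Ind W) = Σ_i #HT_{(w_i,σ_i)}(W)`
  for every such family.

## References

* [Patrikis2019] S. Patrikis, *Variations on a theorem of Tate*, Mem. AMS 258 (2019)
  (arXiv:1207.6724), §2.7.1 and Lemma 7.2.1.
* [NeukirchANT1999] J. Neukirch, *Algebraic Number Theory* (1999), Ch. II (8.1)–(8.3).
* [SerreAbelianLadic1968] J.-P. Serre, *Abelian ℓ-adic representations and elliptic curves* (1968),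
  Ch. II §3.1.
-/

noncomputable section

open scoped NumberField
open NumberField IsDedekindDomain Field

namespace Literature.NumberTheory.PAdicHodge

open Literature.NumberTheory.GaloisRepresentations

variable (K E : Type) [Field K] [NumberField K] [Field E] [NumberField E] [Algebra K E] (d : ℕ)
  (hd : Module.finrank K E = d) (ℓ : ℕ) [Fact ℓ.Prime] (n : ℕ) (W : FramedGaloisRep E (PadicAlgCl ℓ) n)
  (v : HeightOneSpectrum (𝓞 K)) (hv : ((ℓ : ℕ) : 𝓞 K) ∈ v.asIdeal) (τ : PinnedLabel ℓ v hv)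

/-- **`HT_{(v,τ)}(Ind_{Γ_E}^{Γ_K} W) = Σ_i HT_{(w_i,σ_i)}(W)` for EVERY family of `[E : K]` labels
`(w_i, σ_i)` of `E` above `(v, τ)` with pairwise distinct global embeddings** (Patrikis 2019,
Lemma 7.2.1, with the indexing set made free: any enumeration of the `[E : K]` embeddings
`E → ℚ̄_ℓ` extending `τ.emb`, Neukirch II (8.1)–(8.3)).  From the discharged schema
`labelledHodgeTateWeightsAtLabel_induce` (some family), the permutation matching two families
(`PinnedLabel.range_emb_eq_of_labels_above`) and the dependence of `HT_{(w,σ)}` on `σ.emb` only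
(`labelledHodgeTateWeightsAtLabel_eq_of_emb_eq`).
[cite: Patrikis2019, Lemma 7.2.1 and §2.7.1] [cite: NeukirchANT1999, Ch. II (8.1)–(8.3)] -/
theorem labelledHodgeTateWeightsAtLabel_induce_eq_sum (w : Fin d → HeightOneSpectrum (𝓞 E))
    (hw : ∀ i, ((ℓ : ℕ) : 𝓞 E) ∈ (w i).asIdeal) (σ : ∀ i, PinnedLabel ℓ (w i) (hw i))
    (hσ : ∀ i, (σ i).emb.comp (algebraMap K E) = τ.emb)
    (hinj : Function.Injective fun i => (σ i).emb) :
    labelledHodgeTateWeightsAtLabel (W.induce K hd) v hv τ =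
      ∑ i, labelledHodgeTateWeightsAtLabel W (w i) (hw i) (σ i) := by
  classical
  obtain ⟨w₀, hw₀, σ₀, hσ₀, hinj₀, hsum⟩ :=
    labelledHodgeTateWeightsAtLabel_induce K E d hd ℓ n W v hv τ
  obtain ⟨π, hπ⟩ := PinnedLabel.range_emb_eq_of_labels_above hd τ σ₀ σ hσ₀ hinj₀ hσ hinj
  rw [hsum]
  exact (Fintype.sum_equiv π _ _ fun i =>
    labelledHodgeTateWeightsAtLabel_eq_of_emb_eq W (σ i) (σ₀ (π i)) (hπ i).1).symm

/-- **`#HT_{(v,τ)}(Ind W) = Σ_i #HT_{(w_i,σ_i)}(W)`** for every family of `[E : K]` labels of `E`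
above `(v, τ)` with pairwise distinct global embeddings. [cite: Patrikis2019, Lemma 7.2.1] -/
theorem card_labelledHodgeTateWeightsAtLabel_induce (w : Fin d → HeightOneSpectrum (𝓞 E))
    (hw : ∀ i, ((ℓ : ℕ) : 𝓞 E) ∈ (w i).asIdeal) (σ : ∀ i, PinnedLabel ℓ (w i) (hw i))
    (hσ : ∀ i, (σ i).emb.comp (algebraMap K E) = τ.emb)
    (hinj : Function.Injective fun i => (σ i).emb) :
    Multiset.card (labelledHodgeTateWeightsAtLabel (W.induce K hd) v hv τ) =
      ∑ i, Multiset.card (labelledHodgeTateWeightsAtLabel W (w i) (hw i) (σ i)) := by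
  rw [labelledHodgeTateWeightsAtLabel_induce_eq_sum K E d hd ℓ n W v hv τ w hw σ hσ hinj,
    Multiset.card_sum]

/-- **Parallel case: `HT_{(v,τ)}(Ind_{Γ_E}^{Γ_K} W) = [E : K] • S`** when the labelled Hodge–Tate
weights of `W` at every label of `E` above `ℓ` are one multiset `S` (e.g. `W` a power of the
cyclotomic character up to finite order, the case of the tree's
`labelledHodgeTateWeightsAt_induce_of_parallel`; here any rank and any `S`).
[cite: Patrikis2019, Lemma 7.2.1 and Lemma 2.2.4] [cite: SerreAbelianLadic1968, Ch. III §1.1] -/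
theorem labelledHodgeTateWeightsAtLabel_induce_of_forall_eq (S : Multiset ℤ)
    (hS : ∀ (w : HeightOneSpectrum (𝓞 E)) (hw : ((ℓ : ℕ) : 𝓞 E) ∈ w.asIdeal) (σ : PinnedLabel ℓ w hw),
      labelledHodgeTateWeightsAtLabel W w hw σ = S) :
    labelledHodgeTateWeightsAtLabel (W.induce K hd) v hv τ = d • S := by
  obtain ⟨w₀, hw₀, σ₀, -, -, hsum⟩ :=
    labelledHodgeTateWeightsAtLabel_induce K E d hd ℓ n W v hv τ
  rw [hsum, Finset.sum_congr rfl fun i _ => hS (w₀ i) (hw₀ i) (σ₀ i), Finset.sum_const,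
    Finset.card_univ, Fintype.card_fin]

end Literature.NumberTheory.PAdicHodge

end
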